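import Summits.ValiantsHypothesis.ValiantsHypothesis.Theorems.BarrierLeverDefinableEquationsCT23Dichotomy
import Literature.Barriers.ValiantsHypothesis.CT23Lemma47Holds
import HarnessLib

/-!
# Crux `BarrierLever.DefinableEquations` (stmt-8745) / `SingleSizeEquations` (stmt-8749) —
# the CT23 DICHOTOMY is now UNCONDITIONAL

`Theorems/BarrierLeverDefinableEquationsCT23Dichotomy.lean` (val-np-p5 g8) proves the Chatterjee–Tengse
dichotomy for the crux — for every size exponent `b`, EITHER the inner statement of
`SingleSizeEquations` holds at `b`, OR for every level `a`, infinitely often in `n`, CT23's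
projection-circuit equation pulled back to coefficient space is a nonzero equation of
`SmallCircuits ℂ n b` outside the level-`a` Boolean sums — CONDITIONALLY on the named fact
`CT23_lemma_4_7` (Chatterjee–Tengse 2023, Lemma 4.7: a `VPSPACE⁰`-type annihilator of `VP(n, d, s)`).
That fact has since been PROVED in the tree (`Literature.Barriers.ValiantsHypothesis.CT23_lemma_4_7_holds`,
`Literature/Barriers/ValiantsHypothesis/CT23Lemma47Holds.lean`, val-lit t18 g8, on the CT23 engine of
val-lit p2/t20/t24). This file records the UNCONDITIONAL forms: `dichotomy_holds`,
`singleSizeEquations_or_separation_holds`.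

SUPPORT for item `SingleSizeEquations` (stmt-ValiantsHypothesis-8749); it does not close it (a
dichotomy, not a verdict). Honest framing: nothing here is progress on `VP ≠ VNP`, which is NOT proved;
the crux `DefinableEquations` stays OPEN.
-/

-- `Summit.ValiantsHypothesis.ValiantsHypothesis.…` repeats a component by the D-0017 layout
-- (single-conjunct summit), which the `dupNamespace` linter flags; the name is mandated.
set_option linter.dupNamespace false

noncomputable section

namespace Summit.ValiantsHypothesis.ValiantsHypothesis.Theorems.BarrierLeverDefinableEquations

open MvPolynomial
open Literature.Computability.AlgebraicComplexity Literature.Barriers.ValiantsHypothesis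
open Summit.ValiantsHypothesis.ValiantsHypothesis.Theses.BarrierLever
open scoped BigOperators

namespace CT23Dichotomy

/-- **CT23 DICHOTOMY for the crux, rung by rung — UNCONDITIONAL.** For every size exponent `b`,
EITHER the inner statement of `SingleSizeEquations` / `DefinableEquations` holds at `b` (some level
`a`, eventually in `n`: a nonzero level-`a` Boolean sum vanishing on `coeff(SmallCircuits ℂ n b)`), OR
for every level `a`, for infinitely many `n`, CT23's explicit equation `D = P ∘ Vᵀ` (`P` a multilinear
integer polynomial of constant-free projection-circuit size `≤ n^c` with workspace, `V` an invertible
change of coordinates) is a nonzero equation of `SmallCircuits ℂ n b` that is NOT the Boolean sum of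
any level-`a` datum. (`dichotomy` of the conditional file applied to the tree's proof
`CT23_lemma_4_7_holds` of Chatterjee–Tengse 2023, Lemma 4.7.)
[cite: ChatterjeeTengse2023, Lemma 4.7 and Prop. 4.6] -/
theorem dichotomy_holds (b : ℕ) :
    (∃ a n₀ : ℕ, ∀ n ≥ n₀, ∃ q : ℕ, q ≤ Nat.choose (2 * n) n ^ a ∧
      ∃ H : MvPolynomial (↥(degLEMonomials n) ⊕ Fin q) ℂ,
        complexity H ≤ Nat.choose (2 * n) n ^ a ∧ H.totalDegree ≤ Nat.choose (2 * n) n ^ a ∧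
        boolSum H ≠ 0 ∧
        ∀ f ∈ SmallCircuits ℂ n b, eval (coeffVector (degLEMonomials n) f) (boolSum H) = 0) ∨
    (∃ c : ℕ, ∀ a n₀ : ℕ, ∃ n, n₀ ≤ n ∧
      ∃ (t : ℕ) (P : MvPolynomial ↥(degLEMonomials n) ℤ)
        (Q : ProjCircuit ℤ (↥(degLEMonomials n) ⊕ Fin t)) (D : MvPolynomial ↥(degLEMonomials n) ℂ),
        P ≠ 0 ∧ (∀ v, P.degreeOf v ≤ 1) ∧ Q.IsFanInTwo ∧ Q.HasSignConstants ∧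
        Q.Computes (rename Sum.inl P) ∧ t ≤ n ^ c ∧ Q.size ≤ n ^ c ∧
        (∃ A : Matrix ↥(degLEMonomials n) ↥(degLEMonomials n) ℂ, IsUnit A.det ∧
          D = linSubst _ ℂ A (MvPolynomial.map (Int.castRingHom ℂ) P)) ∧
        D ≠ 0 ∧ (∀ f ∈ SmallCircuits ℂ n b, eval (coeffVector (degLEMonomials n) f) D = 0) ∧
        ∀ q : ℕ, q ≤ Nat.choose (2 * n) n ^ a →
          ∀ H : MvPolynomial (↥(degLEMonomials n) ⊕ Fin q) ℂ,
            complexity H ≤ Nat.choose (2 * n) n ^ a → H.totalDegree ≤ Nat.choose (2 * n) n ^ a →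
            boolSum H ≠ D) :=
  dichotomy CT23_lemma_4_7_holds b

/-- **`SingleSizeEquations ∨ (separation at some rung)` — UNCONDITIONAL.** With the route's decl
`SingleSizeEquations` (item stmt-ValiantsHypothesis-8749): if the crux's single-size form fails then
at some `b`, for every level `a` and infinitely often in `n`, CT23's equation (pulled back to
coefficient space) is a nonzero equation of `SmallCircuits ℂ n b` outside the level-`a` Boolean sums.
(`singleSizeEquations_or_separation` applied to `CT23_lemma_4_7_holds`.)
[cite: ChatterjeeTengse2023, Lemma 4.7] -/
theorem singleSizeEquations_or_separation_holds :
    SingleSizeEquations ∨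
    (∃ b c : ℕ, ∀ a n₀ : ℕ, ∃ n, n₀ ≤ n ∧
      ∃ (t : ℕ) (P : MvPolynomial ↥(degLEMonomials n) ℤ)
        (Q : ProjCircuit ℤ (↥(degLEMonomials n) ⊕ Fin t)) (D : MvPolynomial ↥(degLEMonomials n) ℂ),
        P ≠ 0 ∧ (∀ v, P.degreeOf v ≤ 1) ∧ Q.IsFanInTwo ∧ Q.HasSignConstants ∧
        Q.Computes (rename Sum.inl P) ∧ t ≤ n ^ c ∧ Q.size ≤ n ^ c ∧
        (∃ A : Matrix ↥(degLEMonomials n) ↥(degLEMonomials n) ℂ, IsUnit A.det ∧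
          D = linSubst _ ℂ A (MvPolynomial.map (Int.castRingHom ℂ) P)) ∧
        D ≠ 0 ∧ (∀ f ∈ SmallCircuits ℂ n b, eval (coeffVector (degLEMonomials n) f) D = 0) ∧
        ∀ q : ℕ, q ≤ Nat.choose (2 * n) n ^ a →
          ∀ H : MvPolynomial (↥(degLEMonomials n) ⊕ Fin q) ℂ,
            complexity H ≤ Nat.choose (2 * n) n ^ a → H.totalDegree ≤ Nat.choose (2 * n) n ^ a →
            boolSum H ≠ D) :=
  singleSizeEquations_or_separation CT23_lemma_4_7_holds

end CT23Dichotomy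

end Summit.ValiantsHypothesis.ValiantsHypothesis.Theorems.BarrierLeverDefinableEquations

end
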